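import Summits.CriticalPhenomena.PercolationContinuityZ3.Theorems.PercNearOneGluingNoHeavyLowerTailSahiLatinZeroBottomFibrewise
import Summits.CriticalPhenomena.PercolationContinuityZ3.Theorems.PercNearOneGluingNoHeavyLowerTailSahiLatinZeroBottomCoreGeneral

/-!
# `NoHeavyLowerTail` (crux stmt-CriticalPhenomena-4575), Sahi programme (prim-master-conj gen 50): THE THRESHOLD-RELAXED BRIDGE, part 1/3 — the
# `x₀`-chain: densities of the instance `P = [x₀ = 2] ⊂ P′ = [x₀ ≥ 1]`, the chain bound `mRB`, and the fibre inequalities for `η ∈ T` and for `J_SS = {2}`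

Support file (`--supports stmt-CriticalPhenomena-4575`; small definitions (`pt1`, `lvl`, `mRB`) + proofs, no `sorry`, standard axioms; the case analyses
`mRB_le_in`, `mRB_le_out_two` are generated (HOME/lean-g50/gen_rb.py) exhaustive enumerations of the up-sets of the 3-chain, each leaf closed by `linarith`).  Parts 2/3 and 3/3: `…RelaxedBridgeCases`
(remaining fibre inequalities), `…RelaxedBridge` (the sum bound, `grid4_relaxedBridge`, the family `IsRelaxPad` and the theorem).  Memo `run/shared/lean/prim/prim-l12/FROM-prim-master-conj-g50-GENERAL-CORE.md` §8.  Nothing here asserts the crux, Kahn's conjecture or (C¼).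

THE MATHEMATICS.  On `[3]^{Fin 1 ⊕ V}` take `P = {x₀ = 2}`, `b = {x₀ = 1}` (so `P′ = {x₀ ≥ 1}`: the prime RELAXES the threshold of `P` on `P`'s own
coordinate — not a private cut, outside `IsCutPad`), `Q = Ω × T`, `c = Ω × Tᶜ` for an ARBITRARY `T ⊆ [3]^V`.  The pointwise relaxation fails here, but the
FIBREWISE relaxation of `…ZeroBottomFibrewise` (exact along `x₀`, pointwise along `V`) succeeds: for `η ∈ [3]^V` with `β̄ = N_{Tᶜ}(η)`, `q = |V|`, the minimum
of the `x₀`-chain problem over all admissible nested up-sets of the 3-chain is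
   `m(η) = min(2·2^q − 6β̄, −2β̄)` (`η ∈ T`),   `m(η) = min(4·2^q − 2β̄, 7·2^q − 6β̄)` (`η ∉ T`)
(`mRB`; `mRB_le_in`, `mRB_le_out_two` here, `mRB_le_out_onetwo`, `mRB_le_out_univ`, `mRB_le` in part 2: the 3-chain has four up-sets, so the admissible
families are finitely many), and
`Σ_η m(η) ≥ 2^q·|Tᶜ| ≥ 0` by the ONE-BLOCK LEMMA of `…ZeroBottomBlock` applied to the cut `(T, Tᶜ)` of `K₃^{⊗V}` (`sum_mRB_nonneg`).  Hence
`grid4_relaxedBridge`, and with the factor lifts of `…ZeroBottomCoupling` the family `IsRelaxPad` (relaxed-bridge cores, closed under arbitrary up-set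
factors on either side): **`three_kappa_top_le_two_kappa_lowerStep_of_isRelaxPad`** — TOP₁(3/2) for `P = A × [x₀=2]`, `P′ = A × [x₀ ≥ 1]` (`A` any up-set
factor), `Q′ = B × Ω`, `Q = B × T`, every dimension.  HONEST LABEL: one non-private shape; general non-private cuts (conjecture (HC) of the memo), shared
primes, (C¼), TOP₁, FBP(d ≥ 5), Kahn remain OPEN. [this work]
-/

namespace Summit.CriticalPhenomena.PercolationContinuityZ3.Theorems.SahiLatin

open Finset

/-! ## §1  The three-point block `[3]^{Fin 1}` -/

/-- The point of `[3]^{Fin 1}` with level `t`. [this work] -/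
def pt1 (t : Fin 3) : Pt (Fin 1) := fun _ => t

/-- The level set `{x₀ = t}` of `[3]^{Fin 1}`. [this work] -/
def lvl (t : Fin 3) : Finset (Pt (Fin 1)) := univ.filter fun w => w 0 = t

/-- Every point of `[3]^{Fin 1}` is a `pt1`. [this work] -/
theorem eq_pt1 (w : Pt (Fin 1)) : w = pt1 (w 0) := by
  funext i; rw [Fin.fin_one_eq_zero i]; rfl

/-- Sums over `[3]^{Fin 1}` are three-term sums. [this work] -/
theorem sum_pt1 (g : Pt (Fin 1) → ℤ) : ∑ w, g w = g (pt1 0) + g (pt1 1) + g (pt1 2) := by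
  rw [← Fintype.sum_equiv (Equiv.funUnique (Fin 1) (Fin 3)).symm (fun t => g (pt1 t)) g (fun t => rfl), Fin.sum_univ_three]

/-- Indicator table of the level sets (finite check). [this work] -/
theorem ind_lvl_pt1 : ∀ s t : Fin 3, ind (lvl t) (pt1 s) = if s = t then 1 else 0 := by decide

/-- Link-count table of the level sets: `N_{lvl t}(pt1 s) = [s ≠ t]` (finite check). [this work] -/
theorem N_lvl_pt1 : ∀ s t : Fin 3, N (lvl t) (pt1 s) = if s = t then 0 else 1 := by decide

/-- Numeral table: indicators of the level sets at the three points. [this work] -/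
theorem ind_lvl_table :
    ind (lvl 1) (pt1 0) = 0 ∧ ind (lvl 1) (pt1 1) = 1 ∧ ind (lvl 1) (pt1 2) = 0 ∧
    ind (lvl 2) (pt1 0) = 0 ∧ ind (lvl 2) (pt1 1) = 0 ∧ ind (lvl 2) (pt1 2) = 1 := by decide

/-- Numeral table: link counts of the level sets at the three points (in `ℤ`). [this work] -/
theorem N_lvl_table :
    (N (lvl 1) (pt1 0) : ℤ) = 1 ∧ (N (lvl 1) (pt1 1) : ℤ) = 0 ∧ (N (lvl 1) (pt1 2) : ℤ) = 1 ∧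
    (N (lvl 2) (pt1 0) : ℤ) = 1 ∧ (N (lvl 2) (pt1 1) : ℤ) = 1 ∧ (N (lvl 2) (pt1 2) : ℤ) = 0 := by
  refine ⟨?_, ?_, ?_, ?_, ?_, ?_⟩ <;> simp [N_lvl_pt1]

/-- The four up-sets of the 3-chain `[3]^{Fin 1}`. [this work] -/
theorem upperSet_pt1_cases (J : Finset (Pt (Fin 1))) (hJ : IsUpperSet (J : Set (Pt (Fin 1)))) :
    J = ∅ ∨ J = {pt1 2} ∨ J = {pt1 1, pt1 2} ∨ J = univ := by
  have up : ∀ s t : Fin 3, s ≤ t → pt1 s ∈ J → pt1 t ∈ J := fun s t hst hs => hJ (fun _ => hst) hs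
  have key : ∀ w, w ∈ J ↔ pt1 (w 0) ∈ J := fun w => by rw [← eq_pt1 w]
  by_cases h0 : pt1 0 ∈ J
  · right; right; right
    ext w; simp only [mem_univ, iff_true]; rw [key]
    exact up 0 _ (Fin.zero_le _) h0
  by_cases h1 : pt1 1 ∈ J
  · right; right; left
    ext w; rw [key, mem_insert, mem_singleton]
    constructor
    · intro hw
      have : w 0 ≠ 0 := fun h => h0 (h ▸ hw)
      rcases Fin.exists_succ_eq.mpr this with ⟨j, hj⟩
      fin_cases j
      · left; rw [eq_pt1 w, ← hj]; rfl
      · right; rw [eq_pt1 w, ← hj]; rfl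
    · rintro (hw | hw)
      · rw [hw]; exact h1
      · rw [hw]; exact up 1 2 (by decide) h1
  by_cases h2 : pt1 2 ∈ J
  · right; left
    ext w; rw [key, mem_singleton]
    constructor
    · intro hw
      have e : w 0 = 2 := by
        have a : w 0 ≠ 0 := fun h => h0 (h ▸ hw)
        have b : w 0 ≠ 1 := fun h => h1 (h ▸ hw)
        omega
      rw [eq_pt1 w, e]
    · intro hw; rw [hw]; exact h2
  · left
    ext w; rw [key]; simp only [notMem_empty, iff_false]
    intro hw
    have a : w 0 ≠ 0 := fun h => h0 (h ▸ hw)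
    have b : w 0 ≠ 1 := fun h => h1 (h ▸ hw)
    have c : w 0 ≠ 2 := fun h => h2 (h ▸ hw)
    omega

/-! ## §2  The relaxed-bridge instance and its densities -/

section instance_
variable {V : Type} [Fintype V] [DecidableEq V] (T : Finset (Pt V))

/-- `dSS` of the relaxed bridge at `(w, η)`: `2^{q+2}([w∈lvl 1] + [w∈lvl 2][η∉T])`. [this work] -/
theorem dSS_rb (w : Pt (Fin 1)) (η : Pt V) :
    dSS (cylL (lvl 2) : Finset (Pt (Fin 1 ⊕ V))) (cylL (lvl 1)) (cylR T) (cylR Tᶜ) (Sum.elim w η) =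
      2 ^ (Fintype.card V + 2) * (ind (lvl 1) w + ind (lvl 2) w * (1 - ind T η)) := by
  unfold dSS
  rw [ind_cylL, ind_cylL, ind_cylR, ind_cylR, ind_compl', Fintype.card_sum, Fintype.card_fin]
  simp only [fstPt_elim, sndPt_elim]
  ring

/-- `dSO` of the relaxed bridge. [this work] -/
theorem dSO_rb (w : Pt (Fin 1)) (η : Pt V) :
    dSO (cylL (lvl 2) : Finset (Pt (Fin 1 ⊕ V))) (cylL (lvl 1)) (cylR T) (cylR Tᶜ) (Sum.elim w η) =
      -(ind (lvl 2) w * (2 * (N Tᶜ η : ℤ))) - ind (lvl 1) w * (2 * (N T η : ℤ)) + 3 * (ind (lvl 1) w * (2 * (N Tᶜ η : ℤ))) := by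
  have dQ : (N (cylR T : Finset (Pt (Fin 1 ⊕ V))) (Sum.elim w η) : ℤ) = 2 * N T η := by
    have := N_cylR (U := Fin 1) T (Sum.elim w η); rw [Fintype.card_fin] at this; exact_mod_cast this
  have dc : (N (cylR Tᶜ : Finset (Pt (Fin 1 ⊕ V))) (Sum.elim w η) : ℤ) = 2 * N Tᶜ η := by
    have := N_cylR (U := Fin 1) Tᶜ (Sum.elim w η); rw [Fintype.card_fin] at this; exact_mod_cast this
  unfold dSO
  rw [ind_cylL, ind_cylL, dQ, dc]
  simp only [fstPt_elim]

/-- `dOS` of the relaxed bridge. [this work] -/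
theorem dOS_rb (w : Pt (Fin 1)) (η : Pt V) :
    dOS (cylL (lvl 2) : Finset (Pt (Fin 1 ⊕ V))) (cylL (lvl 1)) (cylR T) (cylR Tᶜ) (Sum.elim w η) =
      -(ind T η * ((N (lvl 1) w : ℤ) * 2 ^ Fintype.card V)) - ind Tᶜ η * ((N (lvl 2) w : ℤ) * 2 ^ Fintype.card V)
        + 3 * (ind Tᶜ η * ((N (lvl 1) w : ℤ) * 2 ^ Fintype.card V)) := by
  have dP : (N (cylL (lvl 2) : Finset (Pt (Fin 1 ⊕ V))) (Sum.elim w η) : ℤ) = N (lvl 2) w * 2 ^ Fintype.card V := by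
    exact_mod_cast N_cylL (V := V) (lvl 2) (Sum.elim w η)
  have db : (N (cylL (lvl 1) : Finset (Pt (Fin 1 ⊕ V))) (Sum.elim w η) : ℤ) = N (lvl 1) w * 2 ^ Fintype.card V := by
    exact_mod_cast N_cylL (V := V) (lvl 1) (Sum.elim w η)
  unfold dOS
  rw [ind_cylR, ind_cylR, dP, db]
  simp only [sndPt_elim]

/-- `dOO` of the relaxed bridge: `−4·N_{lvl 1}(w)·N_{Tᶜ}(η)`. [this work] -/
theorem dOO_rb (w : Pt (Fin 1)) (η : Pt V) :
    dOO (cylL (lvl 2) : Finset (Pt (Fin 1 ⊕ V))) (cylL (lvl 1)) (cylR T) (cylR Tᶜ) (Sum.elim w η) =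
      -4 * ((N (lvl 1) w : ℤ) * (N Tᶜ η : ℤ)) := by
  have l1 : (Lam (cylL (lvl 2) : Finset (Pt (Fin 1 ⊕ V))) (cylR Tᶜ) (Sum.elim w η) : ℤ) = N (lvl 2) w * N Tᶜ η := by
    exact_mod_cast Lam_cylL_cylR (lvl 2) Tᶜ (Sum.elim w η)
  have l2 : (Lam (cylL (lvl 1) : Finset (Pt (Fin 1 ⊕ V))) (cylR T) (Sum.elim w η) : ℤ) = N (lvl 1) w * N T η := by
    exact_mod_cast Lam_cylL_cylR (lvl 1) T (Sum.elim w η)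
  have l3 : (Lam (cylL (lvl 1) : Finset (Pt (Fin 1 ⊕ V))) (cylR Tᶜ) (Sum.elim w η) : ℤ) = N (lvl 1) w * N Tᶜ η := by
    exact_mod_cast Lam_cylL_cylR (lvl 1) Tᶜ (Sum.elim w η)
  have n1 : (N ((cylR T : Finset (Pt (Fin 1 ⊕ V))) ∩ cylL (lvl 1)) (Sum.elim w η) : ℤ) = N (lvl 1) w * N T η := by
    rw [inter_comm]; exact_mod_cast N_cylL_inter_cylR (lvl 1) T (Sum.elim w η)
  have n2 : (N ((cylL (lvl 2) : Finset (Pt (Fin 1 ⊕ V))) ∩ cylR Tᶜ) (Sum.elim w η) : ℤ) = N (lvl 2) w * N Tᶜ η := by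
    exact_mod_cast N_cylL_inter_cylR (lvl 2) Tᶜ (Sum.elim w η)
  have n3 : (N ((cylL (lvl 1) : Finset (Pt (Fin 1 ⊕ V))) ∩ cylR Tᶜ) (Sum.elim w η) : ℤ) = N (lvl 1) w * N Tᶜ η := by
    exact_mod_cast N_cylL_inter_cylR (lvl 1) Tᶜ (Sum.elim w η)
  unfold dOO
  rw [l1, l2, l3, n1, n2, n3]
  ring

/-! ## §3  The chain bound `m(η)` and the fibre inequalities -/

/-- The per-`η` lower bound of the `x₀`-chain problem. [this work] -/
def mRB (η : Pt V) : ℤ :=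
  if η ∈ T then min (2 * 2 ^ Fintype.card V - 6 * (N Tᶜ η : ℤ)) (-2 * (N Tᶜ η : ℤ))
  else min (4 * 2 ^ Fintype.card V - 2 * (N Tᶜ η : ℤ)) (7 * 2 ^ Fintype.card V - 6 * (N Tᶜ η : ℤ))

/-- Fibre inequality, case `η ∈ T` (then `J_SS = J_OS = Ω` are forced): generated case analysis over the up-sets `J_SO ⊇ J_OO`. [this work] -/
theorem mRB_le_in {η : Pt V} (hη : η ∈ T) {JSO JOO : Finset (Pt (Fin 1))}
    (uSO : IsUpperSet (JSO : Set (Pt (Fin 1)))) (uOO : IsUpperSet (JOO : Set (Pt (Fin 1)))) (n1 : JOO ⊆ JSO) (h2SO : pt1 2 ∈ JSO) :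
    min (2 * 2 ^ Fintype.card V - 6 * (N Tᶜ η : ℤ)) (-2 * (N Tᶜ η : ℤ)) ≤
      ∑ w ∈ (univ : Finset (Pt (Fin 1))), dSS (cylL (lvl 2) : Finset (Pt (Fin 1 ⊕ V))) (cylL (lvl 1)) (cylR T) (cylR Tᶜ) (Sum.elim w η)
      + ∑ w ∈ JSO, dSO (cylL (lvl 2) : Finset (Pt (Fin 1 ⊕ V))) (cylL (lvl 1)) (cylR T) (cylR Tᶜ) (Sum.elim w η)
      + ∑ w ∈ (univ : Finset (Pt (Fin 1))), dOS (cylL (lvl 2) : Finset (Pt (Fin 1 ⊕ V))) (cylL (lvl 1)) (cylR T) (cylR Tᶜ) (Sum.elim w η)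
      + ∑ w ∈ JOO, dOO (cylL (lvl 2) : Finset (Pt (Fin 1 ⊕ V))) (cylL (lvl 1)) (cylR T) (cylR Tᶜ) (Sum.elim w η) := by
  have hnc : η ∉ Tᶜ := by simpa using hη
  have hne12 : pt1 1 ≠ pt1 2 := by decide
  have tI := ind_lvl_table
  have tN := N_lvl_table
  have hβ : (N T η : ℤ) + N Tᶜ η = 2 ^ Fintype.card V := by exact_mod_cast N_add_N_compl T η
  have hb0 : (0 : ℤ) ≤ N T η := by positivity
  have hbb0 : (0 : ℤ) ≤ N Tᶜ η := by positivity
  have hX : (0 : ℤ) < 2 ^ Fintype.card V := by positivity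
  have e2 : (2 : ℤ) ^ (Fintype.card V + 2) = 4 * 2 ^ Fintype.card V := by rw [pow_add]; ring
  simp only [dSS_rb, dSO_rb, dOS_rb, dOO_rb, e2]
  simp only [ind_of_mem hη, ind_of_not_mem hnc]
  generalize (N T η : ℤ) = bt at hβ hb0 ⊢
  generalize (N Tᶜ η : ℤ) = bb at hβ hbb0 ⊢
  generalize (2 : ℤ) ^ Fintype.card V = X at hβ hX ⊢
  rcases upperSet_pt1_cases JSO uSO with hSO | hSO | hSO | hSO <;> rcases upperSet_pt1_cases JOO uOO with hOO | hOO | hOO | hOO <;>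
    subst hSO <;> subst hOO
  · exact absurd h2SO (show pt1 2 ∉ (∅ : Finset (Pt (Fin 1))) by decide)
  · exact absurd h2SO (show pt1 2 ∉ (∅ : Finset (Pt (Fin 1))) by decide)
  · exact absurd h2SO (show pt1 2 ∉ (∅ : Finset (Pt (Fin 1))) by decide)
  · exact absurd h2SO (show pt1 2 ∉ (∅ : Finset (Pt (Fin 1))) by decide)
  · simp only [sum_empty, sum_singleton, sum_pt1, tI.1, tI.2.1, tI.2.2.1, tI.2.2.2.1, tI.2.2.2.2.1, tI.2.2.2.2.2, tN.1, tN.2.1, tN.2.2.1]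
    refine min_le_of_left_le ?_
    linarith
  · simp only [sum_singleton, sum_pt1, tI.1, tI.2.1, tI.2.2.1, tI.2.2.2.1, tI.2.2.2.2.1, tI.2.2.2.2.2, tN.1, tN.2.1, tN.2.2.1]
    refine min_le_of_left_le ?_
    linarith
  · exact absurd (n1 (show pt1 1 ∈ ({pt1 1, pt1 2} : Finset (Pt (Fin 1))) by decide)) (show pt1 1 ∉ ({pt1 2} : Finset (Pt (Fin 1))) by decide)
  · exact absurd (n1 (mem_univ (pt1 0))) (show pt1 0 ∉ ({pt1 2} : Finset (Pt (Fin 1))) by decide)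
  · simp only [sum_empty, sum_pair hne12, sum_pt1, tI.1, tI.2.1, tI.2.2.1, tI.2.2.2.1, tI.2.2.2.2.1, tI.2.2.2.2.2, tN.1, tN.2.1, tN.2.2.1]
    refine min_le_of_right_le ?_
    linarith
  · simp only [sum_singleton, sum_pair hne12, sum_pt1, tI.1, tI.2.1, tI.2.2.1, tI.2.2.2.1, tI.2.2.2.2.1, tI.2.2.2.2.2, tN.1, tN.2.1, tN.2.2.1]
    refine min_le_of_right_le ?_
    linarith
  · simp only [sum_pair hne12, sum_pt1, tI.1, tI.2.1, tI.2.2.1, tI.2.2.2.1, tI.2.2.2.2.1, tI.2.2.2.2.2, tN.1, tN.2.1, tN.2.2.1]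
    refine min_le_of_right_le ?_
    linarith
  · exact absurd (n1 (mem_univ (pt1 0))) (show pt1 0 ∉ ({pt1 1, pt1 2} : Finset (Pt (Fin 1))) by decide)
  · simp only [sum_empty, sum_pt1, tI.1, tI.2.1, tI.2.2.1, tI.2.2.2.1, tI.2.2.2.2.1, tI.2.2.2.2.2, tN.1, tN.2.1, tN.2.2.1]
    refine min_le_of_right_le ?_
    linarith
  · simp only [sum_singleton, sum_pt1, tI.1, tI.2.1, tI.2.2.1, tI.2.2.2.1, tI.2.2.2.2.1, tI.2.2.2.2.2, tN.1, tN.2.1, tN.2.2.1]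
    refine min_le_of_right_le ?_
    linarith
  · simp only [sum_pair hne12, sum_pt1, tI.1, tI.2.1, tI.2.2.1, tI.2.2.2.1, tI.2.2.2.2.1, tI.2.2.2.2.2, tN.1, tN.2.1, tN.2.2.1]
    refine min_le_of_right_le ?_
    linarith
  · simp only [sum_pt1, tI.1, tI.2.1, tI.2.2.1, tI.2.2.2.1, tI.2.2.2.2.1, tI.2.2.2.2.2, tN.1, tN.2.1, tN.2.2.1]
    refine min_le_of_right_le ?_
    linarith

/-- Fibre inequality, case `η ∉ T`, `J_SS = ({pt1 2} : Finset (Pt (Fin 1)))`: generated case analysis over `J_SO, J_OS, J_OO`. [this work] -/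
theorem mRB_le_out_two {η : Pt V} (hη : η ∉ T) {JSO JOS JOO : Finset (Pt (Fin 1))}
    (uSO : IsUpperSet (JSO : Set (Pt (Fin 1)))) (uOS : IsUpperSet (JOS : Set (Pt (Fin 1)))) (uOO : IsUpperSet (JOO : Set (Pt (Fin 1))))
    (n1 : JOO ⊆ JSO) (n2 : JOO ⊆ JOS) (n3 : JSO ⊆ ({pt1 2} : Finset (Pt (Fin 1)))) (n4 : JOS ⊆ ({pt1 2} : Finset (Pt (Fin 1)))) (h2SO : pt1 2 ∈ JSO) :
    min (4 * 2 ^ Fintype.card V - 2 * (N Tᶜ η : ℤ)) (7 * 2 ^ Fintype.card V - 6 * (N Tᶜ η : ℤ)) ≤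
      ∑ w ∈ ({pt1 2} : Finset (Pt (Fin 1))), dSS (cylL (lvl 2) : Finset (Pt (Fin 1 ⊕ V))) (cylL (lvl 1)) (cylR T) (cylR Tᶜ) (Sum.elim w η)
      + ∑ w ∈ JSO, dSO (cylL (lvl 2) : Finset (Pt (Fin 1 ⊕ V))) (cylL (lvl 1)) (cylR T) (cylR Tᶜ) (Sum.elim w η)
      + ∑ w ∈ JOS, dOS (cylL (lvl 2) : Finset (Pt (Fin 1 ⊕ V))) (cylL (lvl 1)) (cylR T) (cylR Tᶜ) (Sum.elim w η)
      + ∑ w ∈ JOO, dOO (cylL (lvl 2) : Finset (Pt (Fin 1 ⊕ V))) (cylL (lvl 1)) (cylR T) (cylR Tᶜ) (Sum.elim w η) := by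
  have hc : η ∈ Tᶜ := by simpa using hη
  have h2SS : pt1 2 ∈ ({pt1 2} : Finset (Pt (Fin 1))) := n3 h2SO
  have hne12 : pt1 1 ≠ pt1 2 := by decide
  have tI := ind_lvl_table
  have tN := N_lvl_table
  have hβ : (N T η : ℤ) + N Tᶜ η = 2 ^ Fintype.card V := by exact_mod_cast N_add_N_compl T η
  have hb0 : (0 : ℤ) ≤ N T η := by positivity
  have hbb0 : (0 : ℤ) ≤ N Tᶜ η := by positivity
  have hX : (0 : ℤ) < 2 ^ Fintype.card V := by positivity
  have e2 : (2 : ℤ) ^ (Fintype.card V + 2) = 4 * 2 ^ Fintype.card V := by rw [pow_add]; ring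
  simp only [dSS_rb, dSO_rb, dOS_rb, dOO_rb, e2]
  simp only [ind_of_not_mem hη, ind_of_mem hc]
  generalize (N T η : ℤ) = bt at hβ hb0 ⊢
  generalize (N Tᶜ η : ℤ) = bb at hβ hbb0 ⊢
  generalize (2 : ℤ) ^ Fintype.card V = X at hβ hX ⊢
  rcases upperSet_pt1_cases JSO uSO with hSO | hSO | hSO | hSO <;> rcases upperSet_pt1_cases JOS uOS with hOS | hOS | hOS | hOS <;>
    rcases upperSet_pt1_cases JOO uOO with hOO | hOO | hOO | hOO <;> subst hSO <;> subst hOS <;> subst hOO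
  · exact absurd h2SO (show pt1 2 ∉ (∅ : Finset (Pt (Fin 1))) by decide)
  · exact absurd h2SO (show pt1 2 ∉ (∅ : Finset (Pt (Fin 1))) by decide)
  · exact absurd h2SO (show pt1 2 ∉ (∅ : Finset (Pt (Fin 1))) by decide)
  · exact absurd h2SO (show pt1 2 ∉ (∅ : Finset (Pt (Fin 1))) by decide)
  · exact absurd h2SO (show pt1 2 ∉ (∅ : Finset (Pt (Fin 1))) by decide)
  · exact absurd h2SO (show pt1 2 ∉ (∅ : Finset (Pt (Fin 1))) by decide)
  · exact absurd h2SO (show pt1 2 ∉ (∅ : Finset (Pt (Fin 1))) by decide)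
  · exact absurd h2SO (show pt1 2 ∉ (∅ : Finset (Pt (Fin 1))) by decide)
  · exact absurd h2SO (show pt1 2 ∉ (∅ : Finset (Pt (Fin 1))) by decide)
  · exact absurd h2SO (show pt1 2 ∉ (∅ : Finset (Pt (Fin 1))) by decide)
  · exact absurd h2SO (show pt1 2 ∉ (∅ : Finset (Pt (Fin 1))) by decide)
  · exact absurd h2SO (show pt1 2 ∉ (∅ : Finset (Pt (Fin 1))) by decide)
  · exact absurd h2SO (show pt1 2 ∉ (∅ : Finset (Pt (Fin 1))) by decide)
  · exact absurd h2SO (show pt1 2 ∉ (∅ : Finset (Pt (Fin 1))) by decide)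
  · exact absurd h2SO (show pt1 2 ∉ (∅ : Finset (Pt (Fin 1))) by decide)
  · exact absurd h2SO (show pt1 2 ∉ (∅ : Finset (Pt (Fin 1))) by decide)
  · simp only [sum_empty, sum_singleton, tI.2.2.1, tI.2.2.2.2.2]
    refine min_le_of_left_le ?_
    linarith
  · exact absurd (n2 (show pt1 2 ∈ ({pt1 2} : Finset (Pt (Fin 1))) by decide)) (show pt1 2 ∉ (∅ : Finset (Pt (Fin 1))) by decide)
  · exact absurd (n1 (show pt1 1 ∈ ({pt1 1, pt1 2} : Finset (Pt (Fin 1))) by decide)) (show pt1 1 ∉ ({pt1 2} : Finset (Pt (Fin 1))) by decide)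
  · exact absurd (n1 (mem_univ (pt1 0))) (show pt1 0 ∉ ({pt1 2} : Finset (Pt (Fin 1))) by decide)
  · simp only [sum_empty, sum_singleton, tI.2.2.1, tI.2.2.2.2.2, tN.2.2.1, tN.2.2.2.2.2]
    refine min_le_of_left_le ?_
    linarith
  · simp only [sum_singleton, tI.2.2.1, tI.2.2.2.2.2, tN.2.2.1, tN.2.2.2.2.2]
    refine min_le_of_right_le ?_
    linarith
  · exact absurd (n1 (show pt1 1 ∈ ({pt1 1, pt1 2} : Finset (Pt (Fin 1))) by decide)) (show pt1 1 ∉ ({pt1 2} : Finset (Pt (Fin 1))) by decide)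
  · exact absurd (n1 (mem_univ (pt1 0))) (show pt1 0 ∉ ({pt1 2} : Finset (Pt (Fin 1))) by decide)
  · exact absurd (n4 (show pt1 1 ∈ ({pt1 1, pt1 2} : Finset (Pt (Fin 1))) by decide)) (show pt1 1 ∉ ({pt1 2} : Finset (Pt (Fin 1))) by decide)
  · exact absurd (n4 (show pt1 1 ∈ ({pt1 1, pt1 2} : Finset (Pt (Fin 1))) by decide)) (show pt1 1 ∉ ({pt1 2} : Finset (Pt (Fin 1))) by decide)
  · exact absurd (n1 (show pt1 1 ∈ ({pt1 1, pt1 2} : Finset (Pt (Fin 1))) by decide)) (show pt1 1 ∉ ({pt1 2} : Finset (Pt (Fin 1))) by decide)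
  · exact absurd (n1 (mem_univ (pt1 0))) (show pt1 0 ∉ ({pt1 2} : Finset (Pt (Fin 1))) by decide)
  · exact absurd (n4 (mem_univ (pt1 0))) (show pt1 0 ∉ ({pt1 2} : Finset (Pt (Fin 1))) by decide)
  · exact absurd (n4 (mem_univ (pt1 0))) (show pt1 0 ∉ ({pt1 2} : Finset (Pt (Fin 1))) by decide)
  · exact absurd (n1 (show pt1 1 ∈ ({pt1 1, pt1 2} : Finset (Pt (Fin 1))) by decide)) (show pt1 1 ∉ ({pt1 2} : Finset (Pt (Fin 1))) by decide)
  · exact absurd (n1 (mem_univ (pt1 0))) (show pt1 0 ∉ ({pt1 2} : Finset (Pt (Fin 1))) by decide)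
  · exact absurd (n3 (show pt1 1 ∈ ({pt1 1, pt1 2} : Finset (Pt (Fin 1))) by decide)) (show pt1 1 ∉ ({pt1 2} : Finset (Pt (Fin 1))) by decide)
  · exact absurd (n2 (show pt1 2 ∈ ({pt1 2} : Finset (Pt (Fin 1))) by decide)) (show pt1 2 ∉ (∅ : Finset (Pt (Fin 1))) by decide)
  · exact absurd (n2 (show pt1 1 ∈ ({pt1 1, pt1 2} : Finset (Pt (Fin 1))) by decide)) (show pt1 1 ∉ (∅ : Finset (Pt (Fin 1))) by decide)
  · exact absurd (n1 (mem_univ (pt1 0))) (show pt1 0 ∉ ({pt1 1, pt1 2} : Finset (Pt (Fin 1))) by decide)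
  · exact absurd (n3 (show pt1 1 ∈ ({pt1 1, pt1 2} : Finset (Pt (Fin 1))) by decide)) (show pt1 1 ∉ ({pt1 2} : Finset (Pt (Fin 1))) by decide)
  · exact absurd (n3 (show pt1 1 ∈ ({pt1 1, pt1 2} : Finset (Pt (Fin 1))) by decide)) (show pt1 1 ∉ ({pt1 2} : Finset (Pt (Fin 1))) by decide)
  · exact absurd (n2 (show pt1 1 ∈ ({pt1 1, pt1 2} : Finset (Pt (Fin 1))) by decide)) (show pt1 1 ∉ ({pt1 2} : Finset (Pt (Fin 1))) by decide)
  · exact absurd (n1 (mem_univ (pt1 0))) (show pt1 0 ∉ ({pt1 1, pt1 2} : Finset (Pt (Fin 1))) by decide)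
  · exact absurd (n3 (show pt1 1 ∈ ({pt1 1, pt1 2} : Finset (Pt (Fin 1))) by decide)) (show pt1 1 ∉ ({pt1 2} : Finset (Pt (Fin 1))) by decide)
  · exact absurd (n3 (show pt1 1 ∈ ({pt1 1, pt1 2} : Finset (Pt (Fin 1))) by decide)) (show pt1 1 ∉ ({pt1 2} : Finset (Pt (Fin 1))) by decide)
  · exact absurd (n3 (show pt1 1 ∈ ({pt1 1, pt1 2} : Finset (Pt (Fin 1))) by decide)) (show pt1 1 ∉ ({pt1 2} : Finset (Pt (Fin 1))) by decide)
  · exact absurd (n1 (mem_univ (pt1 0))) (show pt1 0 ∉ ({pt1 1, pt1 2} : Finset (Pt (Fin 1))) by decide)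
  · exact absurd (n3 (show pt1 1 ∈ ({pt1 1, pt1 2} : Finset (Pt (Fin 1))) by decide)) (show pt1 1 ∉ ({pt1 2} : Finset (Pt (Fin 1))) by decide)
  · exact absurd (n3 (show pt1 1 ∈ ({pt1 1, pt1 2} : Finset (Pt (Fin 1))) by decide)) (show pt1 1 ∉ ({pt1 2} : Finset (Pt (Fin 1))) by decide)
  · exact absurd (n3 (show pt1 1 ∈ ({pt1 1, pt1 2} : Finset (Pt (Fin 1))) by decide)) (show pt1 1 ∉ ({pt1 2} : Finset (Pt (Fin 1))) by decide)
  · exact absurd (n1 (mem_univ (pt1 0))) (show pt1 0 ∉ ({pt1 1, pt1 2} : Finset (Pt (Fin 1))) by decide)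
  · exact absurd (n3 (mem_univ (pt1 0))) (show pt1 0 ∉ ({pt1 2} : Finset (Pt (Fin 1))) by decide)
  · exact absurd (n2 (show pt1 2 ∈ ({pt1 2} : Finset (Pt (Fin 1))) by decide)) (show pt1 2 ∉ (∅ : Finset (Pt (Fin 1))) by decide)
  · exact absurd (n2 (show pt1 1 ∈ ({pt1 1, pt1 2} : Finset (Pt (Fin 1))) by decide)) (show pt1 1 ∉ (∅ : Finset (Pt (Fin 1))) by decide)
  · exact absurd (n2 (mem_univ (pt1 0))) (show pt1 0 ∉ (∅ : Finset (Pt (Fin 1))) by decide)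
  · exact absurd (n3 (mem_univ (pt1 0))) (show pt1 0 ∉ ({pt1 2} : Finset (Pt (Fin 1))) by decide)
  · exact absurd (n3 (mem_univ (pt1 0))) (show pt1 0 ∉ ({pt1 2} : Finset (Pt (Fin 1))) by decide)
  · exact absurd (n2 (show pt1 1 ∈ ({pt1 1, pt1 2} : Finset (Pt (Fin 1))) by decide)) (show pt1 1 ∉ ({pt1 2} : Finset (Pt (Fin 1))) by decide)
  · exact absurd (n2 (mem_univ (pt1 0))) (show pt1 0 ∉ ({pt1 2} : Finset (Pt (Fin 1))) by decide)
  · exact absurd (n3 (mem_univ (pt1 0))) (show pt1 0 ∉ ({pt1 2} : Finset (Pt (Fin 1))) by decide)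
  · exact absurd (n3 (mem_univ (pt1 0))) (show pt1 0 ∉ ({pt1 2} : Finset (Pt (Fin 1))) by decide)
  · exact absurd (n3 (mem_univ (pt1 0))) (show pt1 0 ∉ ({pt1 2} : Finset (Pt (Fin 1))) by decide)
  · exact absurd (n2 (mem_univ (pt1 0))) (show pt1 0 ∉ ({pt1 1, pt1 2} : Finset (Pt (Fin 1))) by decide)
  · exact absurd (n3 (mem_univ (pt1 0))) (show pt1 0 ∉ ({pt1 2} : Finset (Pt (Fin 1))) by decide)
  · exact absurd (n3 (mem_univ (pt1 0))) (show pt1 0 ∉ ({pt1 2} : Finset (Pt (Fin 1))) by decide)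
  · exact absurd (n3 (mem_univ (pt1 0))) (show pt1 0 ∉ ({pt1 2} : Finset (Pt (Fin 1))) by decide)
  · exact absurd (n3 (mem_univ (pt1 0))) (show pt1 0 ∉ ({pt1 2} : Finset (Pt (Fin 1))) by decide)

end instance_

end Summit.CriticalPhenomena.PercolationContinuityZ3.Theorems.SahiLatin
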